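import Literature.MathematicalPhysics.QuantumLattice.HubbardTTPrimeCanonicalStatesGrandCanonicalEquilibrium
import Literature.MathematicalPhysics.QuantumLattice.VariationalPrincipleLocalKMSRows
import HarnessLib

/-!
# Charged KMS rows for the CANONICAL thermal class of the 2D `t–t'` Hubbard model, modulo Araki–Moriya's Theorem 12.11

Topic `Literature/MathematicalPhysics/QuantumLattice` (family `hubbard`); companion of
`HubbardTTPrimeCanonicalStatesGrandCanonicalEquilibrium` (canonical thermal torus-limit states are grand-canonical
variational equilibrium states at every supporting chemical potential `μ₀`; free-boundary pressure = torus pressure;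
stationarity from (C-1) by polarisation). Here:

* §3 NAMED FACT `localDKMSOfVariationalPrincipleTTPrime` (stated 2026-08-27; **PROVED in §5, 2026-08-28**:
  `localDKMSOfVariationalPrincipleTTPrime_holds`, from the model-independent `VariationalPrincipleLocalKMSRows`) — Araki–Moriya, Rev. Math.
  Phys. 15 (2003) 93, **Theorem 12.11** (a translation-invariant solution of the `(Φ, β)`-variational principle is a
  `(δ_Φ, β)`-dKMS state on the strictly local algebra; Definition 6.3 (C-1), (C-2); Theorem 5.13 `δ_Φ A = i[H_I, A]`),
  transcribed for the standard potential of the grand-canonical `t–t'` Hubbard interaction in the tree's vocabulary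
  (the companion identifies the pressures; the singleton terms differ from the standard potential by the constant `U/4 − μ`,
  which drops out of both the variational equation and the derivation; (C-2) is written as its equivalent family of tangent
  lines `y log(y/x) = sup {sy − qx : e^{s−1} ≤ q}`, the row shape of `…ThermalStatesKMSRows`).
* §4 CONSEQUENCES MODULO THE NAMED FACT: **for every canonical thermal torus-limit state at `(β; t,t',U; n)`, `0 < n < 2`,
  and every supporting `μ₀`: the stationarity rows `ω(K_{Λ'}Ã − ÃK_{Λ'}) = 0` and the energy–entropy balance rows
  `0 ≤ Re ω(β Ãᴴ[K_{Λ'},Ã] − s ÃᴴÃ + q ÃÃᴴ)` (`e^{s−1} ≤ q`) hold for EVERY local `A` — charged included — with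
  `K_{Λ'} = gcLocalHamiltonianTT' Λ' t t' U μ₀ 0`** (`…of_sectorGibbs_of_localDKMS`) — the row family of
  `IsTorusLimitOfMixture.re_expect_eeb_nonneg_of_gcGibbs` / `…expect_commutator_gcLocalHamiltonianTT'_eq_zero_of_gcGibbs`, now for
  the canonical class («charged rows would need BR II 5.3.15 — not in tree», cell `hubbard-thermal` CERT-THERMAL). The supporting
  `μ₀` is bracketed by the certified `μ`-band of `n` (`HubbardTTPrimeThermalPressureChemicalPotentialBand`), so the rows enter a
  canonical relaxation with `μ₀` as one bounded scalar unknown (the rows are affine in `μ₀`).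

§3 is a `def … : Prop` naming a published theorem; the theorems of §4 take `(hAM : localDKMSOfVariationalPrincipleTTPrime)` and
are CONDITIONAL on it (they say so); feed them `localDKMSOfVariationalPrincipleTTPrime_holds` (§5). No number.
§5 (append 2026-08-28, hubbard-pc-lit-1): the DICTIONARY `(gcInteractionTT' t t' U μ h).localHamiltonian Λ = gcLocalHamiltonianTT' Λ t t' U μ h`
(`spinImbalanceInteraction_localHamiltonian`, `gcInteractionTT'_localHamiltonian`; the number part is `numberInteraction_localHamiltonian` of `PairSourceWindowLocalHamiltonian`, copied privately) and the
DISCHARGE `localDKMSOfVariationalPrincipleTTPrime_holds`: Theorem 12.11 is proved in the tree's formalism for every even finite-range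
interaction on `ℤ^d` in `VariationalPrincipleLocalKMSRows` (not by Araki–Moriya's Mazur/tangent-functional route but by an elementary
pressure-perturbation argument: each tangent-line EEB row is linear in the state; finite-volume EEB of perturbed box Gibbs states,
Peierls–Bogoliubov and the Gibbs variational inequality for the box marginals of `ω`), and specialised here with
`freePressure_gcInteractionTT'_eq`, `meanEnergy_gcInteractionTT'` (`FermionGibbsVariationalPrinciple`, `TIVariationalPressure`).

## Mathlib / tree search

REUSED: `IsTorusLimitOfMixture.tendsto_vonNeumannEntropy_rdm_div_sq_gc_of_sectorGibbs`, `expect_commutator_eq_zero_of_localDKMS`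
(companion); `exists_chemicalPotential_pressureTT'_eq` (`…GrandCanonicalEnsembleEquivalence`); row shapes of `…ThermalStatesKMSRows`.
`lean search 'dKMS|localDKMS'` (2026-08-27): nothing before the companion.

## References

* H. Araki, H. Moriya, *Equilibrium statistical mechanics of fermion lattice systems*, Rev. Math. Phys. 15 (2003) 93–198,
  Theorem 12.11, Definition 6.3, Theorem 5.13. [cite: ArakiMoriya2003, Theorem 12.11]
* O. Bratteli, D. W. Robinson, *Operator Algebras and Quantum Statistical Mechanics 2* (1997), Thm. 5.3.15.
  [cite: BratteliRobinsonII1997, Thm. 5.3.15]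
* H. Fawzi, O. Fawzi, S. O. Scalet, Nat. Commun. 15 (2024) 7394, Thm. 3.1 (the row family). [cite: FawziFawziScalet2024, Thm. 3.1]
-/

noncomputable section

open scoped ComplexOrder BigOperators
open Finset Literature.InformationTheory.Entropy

namespace Literature.MathematicalPhysics.QuantumLattice

open Matrix HubbardWave0 Literature.Probability.LatticeModels ThermodynamicLimit
open _root_.Filter
open scoped _root_.Topology

/-! ### §3 Named fact: Araki–Moriya's Theorem 12.11 for the grand-canonical `t–t'` Hubbard interaction -/

/-- **Araki–Moriya, Theorem 12.11 (variational principle ⇒ differential KMS condition on the strictly local algebra),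
for the grand-canonical `t–t'` Hubbard interaction on `ℤ²`** [cite: ArakiMoriya2003, Theorem 12.11].
Statement as printed (Rev. Math. Phys. 15 (2003) 93, Thm. 12.11): *Let `Φ ∈ 𝒫_BI` and `φ` be a translation invariant state. If
`φ` is a solution of the `(Φ, β)`-variational principle `P(βΦ) = s(φ) − β e_Φ(φ)`, then `φ` is a `(δ_Φ, β)`-dKMS state*, where
(Def. 6.3) a `(δ, β)`-dKMS state satisfies, for every `A` in the domain (here `𝔄_loc`), (C-1) `φ(A⋆ δA)` is purely imaginary and
(C-2) `−iβ φ(A⋆ δA) ≥ S(φ(AA⋆), φ(A⋆A))`, `S(x, y) = y log y − y log x`, and (Thm. 5.13) `δ_Φ A = i[H_I, A]` for `A ∈ 𝔄(I)`, `H_I`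
the sum of the interaction terms meeting `I`.
TRANSCRIPTION (special case, tree vocabulary): the interaction is the finite-range, even, translation covariant
grand-canonical `t–t'` Hubbard interaction at `(t,t',U; μ,h)` (its standard potential differs on singletons by the constant
`U/4 − μ`, which changes neither the variational equation nor `δ_Φ`); `P(βΦ)` is the tree's `gcPressureTT'Zeeman β t t' U μ h`
(free-boundary = periodic pressure, `tendsto_log_partitionFn_openBox_gc_div_sq`); `s(φ) = lim S(φ_{[0,ℓ)²})/ℓ²` and
`e_Φ(φ) = u(φ) = e_{Φ(t,t',U)}(φ) − μρ(φ) − h m(φ)`, so the hypothesis reads `S(ω_{[0,ℓ)²})/ℓ² → P + βu(ω)`; for `A ∈ 𝔄_Λ` and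
`Λ ⊆ Λ'`, `thicken Λ 1 ⊆ Λ'`: `[H_Λ, A] = [K_{Λ'}, Ã]`, `K_{Λ'} = gcLocalHamiltonianTT' Λ' t t' U μ h`, `Ã = Γ_{Λ⊆Λ'}A`; (C-1) reads
`Im ω(Ãᴴ(K_{Λ'}Ã − ÃK_{Λ'})) = 0` and (C-2) is written as its equivalent family of tangent lines
(`y log(y/x) = sup{sy − qx : e^{s−1} ≤ q}`): `0 ≤ Re ω(β Ãᴴ(K_{Λ'}Ã − ÃK_{Λ'}) − s ÃᴴÃ + q ÃÃᴴ)` for `e^{s−1} ≤ q`. Restricted to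
`β ≥ 0`, `U ≥ 0` (where the tree's pressure is the proven limit).
-- TODO(general form): every `Φ ∈ 𝒫_BI` on `ℤ^ν` and every real `β` (Araki–Moriya Thm. 12.11), with the abstract pressure
-- functional and mean entropy of the CAR algebra. -/
def localDKMSOfVariationalPrincipleTTPrime : Prop :=
  ∀ (β : ℝ), 0 ≤ β → ∀ (t t' U : ℝ), 0 ≤ U → ∀ (μ hz : ℝ) (ω : InfVolFermionState 2), ω.IsTranslationInvariant →
    Tendsto (fun ℓ : ℕ => vonNeumannEntropy (ω.rdm (halfOpenBox 2 ℓ)) / (ℓ : ℝ) ^ 2) atTop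
      (𝓝 (gcPressureTT'Zeeman β t t' U μ hz +
        β * (ω.meanEnergy (hubbardTTPrimeFermionInteraction t t' U) 1 - μ * ω.density -
          hz * ((ω.expect ({0} : Finset (Site 2)) (nAt 0 (mem_singleton_self 0) 0)).re -
            (ω.expect ({0} : Finset (Site 2)) (nAt 0 (mem_singleton_self 0) 1)).re)))) →
    ∀ (Λ Λ' : Finset (Site 2)) (hΛ : Λ ⊆ Λ') (_h8 : thicken Λ 1 ⊆ Λ') (A : FermionOp Λ),
      (ω.expect Λ' ((fermionEmbed (PolySite.incl hΛ) A)ᴴ *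
          (gcLocalHamiltonianTT' Λ' t t' U μ hz * fermionEmbed (PolySite.incl hΛ) A -
            fermionEmbed (PolySite.incl hΛ) A * gcLocalHamiltonianTT' Λ' t t' U μ hz))).im = 0 ∧
      ∀ (s q : ℝ), Real.exp (s - 1) ≤ q →
        0 ≤ (ω.expect Λ'
          (((β : ℝ) : ℂ) • ((fermionEmbed (PolySite.incl hΛ) A)ᴴ *
              (gcLocalHamiltonianTT' Λ' t t' U μ hz * fermionEmbed (PolySite.incl hΛ) A -
                fermionEmbed (PolySite.incl hΛ) A * gcLocalHamiltonianTT' Λ' t t' U μ hz)) -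
            ((s : ℝ) : ℂ) • ((fermionEmbed (PolySite.incl hΛ) A)ᴴ * fermionEmbed (PolySite.incl hΛ) A) +
            ((q : ℝ) : ℂ) • (fermionEmbed (PolySite.incl hΛ) A * (fermionEmbed (PolySite.incl hΛ) A)ᴴ))).re

/-! ### §4 Charged rows for canonical thermal states (conditional on the named fact) -/

namespace InfVolFermionState
section Charged

variable (t t' : ℝ) {U : ℝ} (hU : 0 ≤ U) {β : ℝ} (hβ : 0 < β) {ω : InfVolFermionState 2} {Ls : ℕ → ℕ} {n : ℝ}
include hU hβ

/-- **CHARGED ENERGY–ENTROPY BALANCE ROWS FOR CANONICAL THERMAL STATES (conditional on Araki–Moriya Thm. 12.11).**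
Assume `localDKMSOfVariationalPrincipleTTPrime`. Let `ω` be a canonical thermal torus-limit state at `(β; t,t',U; n)`,
`0 < n < 2`, and `μ₀` a supporting chemical potential of `p(β;·)` at `n`. Then for `Λ ⊆ Λ'` with `thicken Λ 1 ⊆ Λ'`, EVERY
`A ∈ 𝔄_Λ` (charged included) and all `s, q` with `e^{s−1} ≤ q`:
`0 ≤ Re ω(β Ãᴴ(K_{Λ'}Ã − ÃK_{Λ'}) − s ÃᴴÃ + q ÃÃᴴ)`, `K_{Λ'} = gcLocalHamiltonianTT' Λ' t t' U μ₀ 0` — the row shape of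
`IsTorusLimitOfMixture.re_expect_eeb_nonneg_of_gcGibbs`, now for the canonical class.
[cite: ArakiMoriya2003, Theorem 12.11] [cite: FawziFawziScalet2024, Thm. 3.1] -/
theorem IsTorusLimitOfMixture.re_expect_eeb_nonneg_of_sectorGibbs_of_localDKMS
    (hAM : localDKMSOfVariationalPrincipleTTPrime) (hn0 : 0 < n) (hn2 : n < 2)
    (h : ω.IsTorusLimitOfMixture (sectorGibbsCount n) (fun L => sectorGibbsWeightTT' β t t' U n L)
      (fun L => sectorGibbsVectorTT' t t' U n L) Ls)
    (hLs : Tendsto Ls atTop atTop) {μ₀ : ℝ} (hμ₀ : pressureTT' β t t' U n = gcPressureTT' β t t' U μ₀ - β * μ₀ * n)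
    {Λ Λ' : Finset (Site 2)} (hΛ : Λ ⊆ Λ') (h8 : thicken Λ 1 ⊆ Λ') (A : FermionOp Λ) {s q : ℝ}
    (hq : Real.exp (s - 1) ≤ q) :
    0 ≤ (ω.expect Λ'
      (((β : ℝ) : ℂ) • ((fermionEmbed (PolySite.incl hΛ) A)ᴴ *
          (gcLocalHamiltonianTT' Λ' t t' U μ₀ 0 * fermionEmbed (PolySite.incl hΛ) A -
            fermionEmbed (PolySite.incl hΛ) A * gcLocalHamiltonianTT' Λ' t t' U μ₀ 0)) -
        ((s : ℝ) : ℂ) • ((fermionEmbed (PolySite.incl hΛ) A)ᴴ * fermionEmbed (PolySite.incl hΛ) A) +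
        ((q : ℝ) : ℂ) • (fermionEmbed (PolySite.incl hΛ) A * (fermionEmbed (PolySite.incl hΛ) A)ᴴ))).re :=
  (hAM β hβ.le t t' U hU μ₀ 0 ω h.isTranslationInvariant
    (h.tendsto_vonNeumannEntropy_rdm_div_sq_gc_of_sectorGibbs t t' hU hβ hn0 hn2 hLs hμ₀) Λ Λ' hΛ h8 A).2 s q hq

/-- **STATIONARITY ROWS FOR CANONICAL THERMAL STATES w.r.t. the grand-canonical local dynamics (conditional on
Araki–Moriya Thm. 12.11)**: `ω(K_{Λ'}Ã − ÃK_{Λ'}) = 0` for every local `A`, `K_{Λ'} = gcLocalHamiltonianTT' Λ' t t' U μ₀ 0`, at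
every supporting `μ₀`. [cite: ArakiMoriya2003, Theorem 12.11] [cite: FawziFawziScalet2024, Thm. 3.1] -/
theorem IsTorusLimitOfMixture.expect_commutator_gcLocalHamiltonianTT'_eq_zero_of_sectorGibbs_of_localDKMS
    (hAM : localDKMSOfVariationalPrincipleTTPrime) (hn0 : 0 < n) (hn2 : n < 2)
    (h : ω.IsTorusLimitOfMixture (sectorGibbsCount n) (fun L => sectorGibbsWeightTT' β t t' U n L)
      (fun L => sectorGibbsVectorTT' t t' U n L) Ls)
    (hLs : Tendsto Ls atTop atTop) {μ₀ : ℝ} (hμ₀ : pressureTT' β t t' U n = gcPressureTT' β t t' U μ₀ - β * μ₀ * n)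
    {Λ Λ' : Finset (Site 2)} (hΛ : Λ ⊆ Λ') (h8 : thicken Λ 1 ⊆ Λ') (A : FermionOp Λ) :
    ω.expect Λ'
      (gcLocalHamiltonianTT' Λ' t t' U μ₀ 0 * fermionEmbed (PolySite.incl hΛ) A -
        fermionEmbed (PolySite.incl hΛ) A * gcLocalHamiltonianTT' Λ' t t' U μ₀ 0) = 0 :=
  ω.expect_commutator_eq_zero_of_localDKMS hΛ (gcLocalHamiltonianTT' Λ' t t' U μ₀ 0)
    (fun B => (hAM β hβ.le t t' U hU μ₀ 0 ω h.isTranslationInvariant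
      (h.tendsto_vonNeumannEntropy_rdm_div_sq_gc_of_sectorGibbs t t' hU hβ hn0 hn2 hLs hμ₀) Λ Λ' hΛ h8 B).1) A

/-- **Existential packaging**: under the named fact, every canonical thermal torus-limit state at `(β; t,t',U; n)`, `0 < n < 2`,
satisfies the full grand-canonical row family (stationarity + energy–entropy balance for every local generator) at SOME
chemical potential `μ₀` with `p(n) = P(μ₀) − βμ₀n` (hence `μ₀` in the certified `μ`-band of `n`).
[cite: ArakiMoriya2003, Theorem 12.11] -/
theorem IsTorusLimitOfMixture.exists_chemicalPotential_rows_of_sectorGibbs_of_localDKMS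
    (hAM : localDKMSOfVariationalPrincipleTTPrime) (hn0 : 0 < n) (hn2 : n < 2)
    (h : ω.IsTorusLimitOfMixture (sectorGibbsCount n) (fun L => sectorGibbsWeightTT' β t t' U n L)
      (fun L => sectorGibbsVectorTT' t t' U n L) Ls)
    (hLs : Tendsto Ls atTop atTop) :
    ∃ μ₀ : ℝ, pressureTT' β t t' U n = gcPressureTT' β t t' U μ₀ - β * μ₀ * n ∧
      ∀ {Λ Λ' : Finset (Site 2)} (hΛ : Λ ⊆ Λ') (_h8 : thicken Λ 1 ⊆ Λ') (A : FermionOp Λ),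
        ω.expect Λ'
            (gcLocalHamiltonianTT' Λ' t t' U μ₀ 0 * fermionEmbed (PolySite.incl hΛ) A -
              fermionEmbed (PolySite.incl hΛ) A * gcLocalHamiltonianTT' Λ' t t' U μ₀ 0) = 0 ∧
          ∀ (s q : ℝ), Real.exp (s - 1) ≤ q →
            0 ≤ (ω.expect Λ'
              (((β : ℝ) : ℂ) • ((fermionEmbed (PolySite.incl hΛ) A)ᴴ *
                  (gcLocalHamiltonianTT' Λ' t t' U μ₀ 0 * fermionEmbed (PolySite.incl hΛ) A -
                    fermionEmbed (PolySite.incl hΛ) A * gcLocalHamiltonianTT' Λ' t t' U μ₀ 0)) -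
                ((s : ℝ) : ℂ) • ((fermionEmbed (PolySite.incl hΛ) A)ᴴ * fermionEmbed (PolySite.incl hΛ) A) +
                ((q : ℝ) : ℂ) • (fermionEmbed (PolySite.incl hΛ) A * (fermionEmbed (PolySite.incl hΛ) A)ᴴ))).re := by
  obtain ⟨μ₀, hμ₀⟩ := exists_chemicalPotential_pressureTT'_eq hβ.le t t' hU hβ hn0 hn2
  refine ⟨μ₀, hμ₀, fun hΛ h8 A => ⟨?_, fun s q hq => ?_⟩⟩
  · exact h.expect_commutator_gcLocalHamiltonianTT'_eq_zero_of_sectorGibbs_of_localDKMS t t' hU hβ hAM hn0 hn2 hLs hμ₀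
      hΛ h8 A
  · exact h.re_expect_eeb_nonneg_of_sectorGibbs_of_localDKMS t t' hU hβ hAM hn0 hn2 hLs hμ₀ hΛ h8 A hq

end Charged

end InfVolFermionState

/-! ### §5 Dictionary and DISCHARGE of the named fact (append 2026-08-28) -/

section Dictionary

variable {d : ℕ}

/-- A sum over the sites of a region, written with membership proofs, is the sum over its ordered site set.
[cite: ArakiMoriya2003, §4.1 Def. 4.1 (2)] -/
private theorem sum_attach_eq_sum_polySite (Λ : Finset (Site d)) (F : PolySite Λ → FermionOp Λ) :
    ∑ x ∈ Λ.attach, F (PolySite.pt x.1 x.2) = ∑ y : PolySite Λ, F y := by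
  classical
  let e : PolySite Λ ≃ {x // x ∈ Λ} :=
    ⟨fun a => ⟨ofLex a.1, PolySite.ofLex_mem a⟩, fun x => PolySite.pt x.1 x.2, fun a => PolySite.pt_ofLex a,
      fun x => Subtype.ext rfl⟩
  rw [← Finset.univ_eq_attach]
  exact (Fintype.sum_equiv e _ _ fun a => by
    rw [show PolySite.pt (e a).1 (e a).2 = e.symm (e a) from rfl, Equiv.symm_apply_apply]).symm

/-- The local Hamiltonian of an on-site interaction `X ↦ [X = {x}]·f x`: `H_Λ = Σ_{x ∈ Λ} Γ_{{x}⊆Λ} (Φ {x})`.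
[cite: ArakiMoriya2003, §5.1 (local Hamiltonian H(I))] -/
private theorem localHamiltonian_eq_sum_singleton (Ψ : FermionInteraction d)
    (h0 : ∀ X : Finset (Site d), (∀ x : Site d, X ≠ {x}) → Ψ.Φ X = 0) (Λ : Finset (Site d)) :
    Ψ.localHamiltonian Λ = ∑ x ∈ Λ.attach, fermionEmbed (PolySite.incl (singleton_subset_iff.2 x.2)) (Ψ.Φ {x.1}) := by
  classical
  rw [FermionInteraction.localHamiltonian_eq_sum]
  have hsub : Λ.map ⟨fun x => ({x} : Finset (Site d)), singleton_injective⟩ ⊆ Λ.powerset := by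
    intro X hX
    rw [Finset.mem_map] at hX
    obtain ⟨x, hx, rfl⟩ := hX
    exact mem_powerset.2 (singleton_subset_iff.2 hx)
  rw [← sum_subset hsub, sum_map, ← sum_attach]
  · refine sum_congr rfl fun x _ => ?_
    exact dif_pos (singleton_subset_iff.2 x.2)
  · intro X hX hXn
    rw [mem_powerset] at hX
    rw [dif_pos hX, h0 X, map_zero]
    intro x hx
    apply hXn
    rw [Finset.mem_map]
    refine ⟨x, hX (by rw [hx]; exact mem_singleton_self x), ?_⟩
    exact hx.symm

/-- **`H^n_Λ = N_Λ`**: the local Hamiltonian of the particle-number interaction is the total number operator of the region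
(local copy of `numberInteraction_localHamiltonian` of `PairSourceWindowLocalHamiltonian`, not imported here to keep the thermal
file free of the `T = 0` d-wave window machinery). [cite: ArakiMoriya2003, §5.1 (local Hamiltonian H(I))] -/
private theorem numberInteraction_localHamiltonian_eq_totalNumber (Λ : Finset (Site d)) :
    (numberInteraction d).localHamiltonian Λ = (totalNumber : FermionOp Λ) := by
  classical
  rw [localHamiltonian_eq_sum_singleton (numberInteraction d) (fun X hX => numberInteraction_apply_eq_zero hX) Λ, totalNumber,
    ← sum_attach_eq_sum_polySite Λ (fun y => ∑ σ : Fin 2, numberOp y σ)]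
  refine sum_congr rfl fun x _ => ?_
  rw [numberInteraction_apply_singleton, map_add, Fin.sum_univ_two, nAt, nAt, fermionEmbed_numberOp, fermionEmbed_numberOp,
    PolySite.incl_pt]

/-- **`H^m_Λ = M_Λ = N↑_Λ − N↓_Λ`**: the local Hamiltonian of the spin-imbalance interaction is the spin imbalance of the region.
[cite: ArakiMoriya2003, §5.1 (local Hamiltonian H(I))] -/
theorem spinImbalanceInteraction_localHamiltonian (Λ : Finset (Site d)) :
    (spinImbalanceInteraction d).localHamiltonian Λ = (spinImbalance : FermionOp Λ) := by
  classical
  rw [localHamiltonian_eq_sum_singleton (spinImbalanceInteraction d) (fun X hX => spinImbalanceInteraction_apply_eq_zero hX) Λ,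
    spinImbalance, ← sum_attach_eq_sum_polySite Λ (fun y => numberOp y 0 - numberOp y 1)]
  refine sum_congr rfl fun x _ => ?_
  rw [spinImbalanceInteraction_apply_singleton, map_sub, nAt, nAt, fermionEmbed_numberOp, fermionEmbed_numberOp, PolySite.incl_pt]

/-- **THE DICTIONARY**: the local Hamiltonian of the grand-canonical `t–t'` interaction `Φ(t,t',U) − μ·n − h·m` on a region is the
local grand-canonical Hamiltonian `K_Λ = H^{tt'}_Λ − μN_Λ − h(N↑_Λ − N↓_Λ)` of the thermal toolkit.
[cite: BratteliRobinsonII1997, Thm. 6.2.4] -/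
theorem gcInteractionTT'_localHamiltonian (t t' U μ hz : ℝ) (Λ : Finset (Site 2)) :
    (gcInteractionTT' t t' U μ hz).localHamiltonian Λ = gcLocalHamiltonianTT' Λ t t' U μ hz := by
  rw [gcInteractionTT', FermionInteraction.localHamiltonian_linearFamily, Fin.sum_univ_two, gcLocalHamiltonianTT'_eq]
  simp only [Matrix.cons_val_zero, Matrix.cons_val_one]
  rw [numberInteraction_localHamiltonian_eq_totalNumber, spinImbalanceInteraction_localHamiltonian]
  push_cast
  rw [neg_smul, neg_smul, sub_eq_add_neg, sub_eq_add_neg, add_assoc]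

end Dictionary

/-- **DISCHARGE OF THE NAMED FACT: Araki–Moriya's Theorem 12.11 for the grand-canonical `t–t'` Hubbard interaction HOLDS.** Every
translation-invariant state of the 2D lattice-fermion algebra with `S(ω_{[0,ℓ)²})/ℓ² → P(β;t,t',U;μ,h) + β u(ω)` (`β ≥ 0`, `U ≥ 0`)
satisfies, for `Λ ⊆ Λ'` with `thicken Λ 1 ⊆ Λ'` and EVERY `A ∈ 𝔄_Λ`: `(C-1)` `Im ω(Ãᴴ(K_{Λ'}Ã − ÃK_{Λ'})) = 0` and `(C-2)`
`0 ≤ Re ω(β Ãᴴ(K_{Λ'}Ã − ÃK_{Λ'}) − s ÃᴴÃ + q ÃÃᴴ)` for `e^{s−1} ≤ q`. Proof: the model-independent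
`re_expect_eebRow_nonneg_of_variationalPrinciple` / `im_expect_conjTranspose_mul_commutator_eq_zero_of_variationalPrinciple(_zero)`
(`VariationalPrincipleLocalKMSRows`) for `Ψ = gcInteractionTT'` (Hermitian, even, translation covariant, range `1`), with
`P_free = gcPressureTT'Zeeman` (`freePressure_gcInteractionTT'_eq`), `e_Ψ = u` (`meanEnergy_gcInteractionTT'`) and the dictionary
`gcInteractionTT'_localHamiltonian`. Hence every theorem of §4 holds unconditionally. [cite: ArakiMoriya2003, Theorem 12.11]
[cite: FannesVerbeure1978] -/
theorem localDKMSOfVariationalPrincipleTTPrime_holds : localDKMSOfVariationalPrincipleTTPrime := by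
  intro β hβ t t' U hU μ hz ω hω hS Λ Λ' hΛ h8 A
  have hHΨ := gcInteractionTT'_isHermitian t t' U μ hz
  have hEΨ := gcInteractionTT'_isEven t t' U μ hz
  have hTΨ := gcInteractionTT'_isTranslationInvariant t t' U μ hz
  have hRΨ := gcInteractionTT'_hasFiniteRange t t' U μ hz
  have hS' : Tendsto (fun ℓ : ℕ => vonNeumannEntropy (ω.rdm (halfOpenBox 2 ℓ)) / (ℓ : ℝ) ^ 2) atTop
      (𝓝 ((gcInteractionTT' t t' U μ hz).freePressure β + β * ω.meanEnergy (gcInteractionTT' t t' U μ hz) 1)) := by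
    rwa [freePressure_gcInteractionTT'_eq hβ t t' hU μ hz, ω.meanEnergy_gcInteractionTT']
  have hK := gcInteractionTT'_localHamiltonian t t' U μ hz Λ'
  refine ⟨?_, fun s q hq => ?_⟩
  · rcases hβ.eq_or_lt with h0 | hpos
    · subst h0
      have h := hω.im_expect_conjTranspose_mul_commutator_eq_zero_of_variationalPrinciple_zero two_pos hHΨ hEΨ hTΨ hRΨ hS' h8 A
      rw [hK] at h
      exact h
    · have h := hω.im_expect_conjTranspose_mul_commutator_eq_zero_of_variationalPrinciple two_pos hHΨ hEΨ hTΨ hRΨ hβ hS'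
        hpos h8 A
      rw [hK] at h
      exact h
  · have h := hω.re_expect_eebRow_nonneg_of_variationalPrinciple two_pos hHΨ hEΨ hTΨ hRΨ hβ hS' h8 A hq
    rw [hK] at h
    exact h

namespace InfVolFermionState
section Unconditional

variable (t t' : ℝ) {U : ℝ} (hU : 0 ≤ U) {β : ℝ} (hβ : 0 < β) {ω : InfVolFermionState 2} {Ls : ℕ → ℕ} {n : ℝ}
include hU hβ

/-- **UNCONDITIONAL charged rows for canonical thermal states**: every canonical thermal torus-limit state at `(β; t,t',U; n)`,
`0 < n < 2`, satisfies the full grand-canonical row family (stationarity + energy–entropy balance for EVERY local generator,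
charged included) at some chemical potential `μ₀` with `p(n) = P(μ₀) − βμ₀n` — §4 fed with the discharge.
[cite: ArakiMoriya2003, Theorem 12.11] -/
theorem IsTorusLimitOfMixture.exists_chemicalPotential_rows_of_sectorGibbs (hn0 : 0 < n) (hn2 : n < 2)
    (h : ω.IsTorusLimitOfMixture (sectorGibbsCount n) (fun L => sectorGibbsWeightTT' β t t' U n L)
      (fun L => sectorGibbsVectorTT' t t' U n L) Ls)
    (hLs : Tendsto Ls atTop atTop) :
    ∃ μ₀ : ℝ, pressureTT' β t t' U n = gcPressureTT' β t t' U μ₀ - β * μ₀ * n ∧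
      ∀ {Λ Λ' : Finset (Site 2)} (hΛ : Λ ⊆ Λ') (_h8 : thicken Λ 1 ⊆ Λ') (A : FermionOp Λ),
        ω.expect Λ'
            (gcLocalHamiltonianTT' Λ' t t' U μ₀ 0 * fermionEmbed (PolySite.incl hΛ) A -
              fermionEmbed (PolySite.incl hΛ) A * gcLocalHamiltonianTT' Λ' t t' U μ₀ 0) = 0 ∧
          ∀ (s q : ℝ), Real.exp (s - 1) ≤ q →
            0 ≤ (ω.expect Λ'
              (((β : ℝ) : ℂ) • ((fermionEmbed (PolySite.incl hΛ) A)ᴴ *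
                  (gcLocalHamiltonianTT' Λ' t t' U μ₀ 0 * fermionEmbed (PolySite.incl hΛ) A -
                    fermionEmbed (PolySite.incl hΛ) A * gcLocalHamiltonianTT' Λ' t t' U μ₀ 0)) -
                ((s : ℝ) : ℂ) • ((fermionEmbed (PolySite.incl hΛ) A)ᴴ * fermionEmbed (PolySite.incl hΛ) A) +
                ((q : ℝ) : ℂ) • (fermionEmbed (PolySite.incl hΛ) A * (fermionEmbed (PolySite.incl hΛ) A)ᴴ))).re :=
  h.exists_chemicalPotential_rows_of_sectorGibbs_of_localDKMS t t' hU hβ localDKMSOfVariationalPrincipleTTPrime_holds hn0 hn2 hLs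

end Unconditional
end InfVolFermionState

end Literature.MathematicalPhysics.QuantumLattice


end
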